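/-
Copyright (c) 2026. All rights reserved.
Released under Apache 2.0 license as described in the file LICENSE.
-/
import Mathlib
import Summits.NavierStokesRegularity.NavierStokesRegularity.Theorems.EulerZoomLiouvillePowerGaugeEulerLiouvilleSelfSimilarKelvinFlowC2
import Literature.Analysis.FluidPDE.SelfSimilarEulerProfile

/-!
# Momentum along labels: the velocity of a self-similar Euler profile along backward orbits

SEEDS-R43 §1 (nsreg-p2 g33, spec t43-D) in the tree's BACKWARD convention, for the crux class
`PowerGaugeEulerLiouville` (MODEL lattice only; the crux `stmt-…-19832` is a class of
Euler / Navier–Stokes strata, not Navier–Stokes regularity).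

Setting (as in the plates t40a / t42a): `U, P` a self-similar Euler profile with exponent `γ` and
centre `0` (`IsSelfSimilarEulerProfile γ 0 U P`), `V ∈ C¹` a cut-off of `U` with bounded
derivative agreeing with `U` on `ball 0 R_big`, and `Ψ_σ y = ODE.evolutionMap (selfSimilarTransport γ 0 V) 0 (−σ) y`
the backward similarity flow (`Ψ' = −(γΨ + V(Ψ))`, tree `C2.Kelvin.hasDerivAt_flow_neg`).

* (D1) `hasDerivAt_velocity_flow_neg` — inside the ball, `d/dσ U(Ψ_σ y) = (1−γ) U(Ψ_σ y) + ∇P(Ψ_σ y)`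
  (chain rule + the profile equation `(1−γ)U + DU[γy + U] + ∇P = 0`);
* (D2) `hasDerivAt_inner_velocity_flow_neg` — the same paired with a fixed direction `e`;
* (D3) `hasDerivAt_exp_mul_inner_velocity_flow_neg` — the integrating factor `e^{−(1−γ)σ}` kills
  the amplification term: `d/dσ (e^{−(1−γ)σ}⟪U(Ψ_σ y), e⟫) = e^{−(1−γ)σ}⟪∇P(Ψ_σ y), e⟫`;
* (D4) `exp_mul_inner_velocity_sub_eq_integral` — DUHAMEL:
  `e^{−(1−γ)S}⟪U(Ψ_S y), e⟫ − ⟪U y, e⟫ = ∫₀^S e^{−(1−γ)r}⟪∇P(Ψ_r y), e⟫ dr` while the orbit stays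
  in the ball on `[0, S]`;
* (D5) `abs_inner_velocity_le_of_pressure_bound` — hence, for `γ < 1` and `|⟪∇P(Ψ_r y), e⟫| ≤ B`
  on `[0, S]`: `|⟪U(Ψ_S y), e⟫| ≤ e^{(1−γ)S} (|⟪U y, e⟫| + B S)`.

Reading: along a BACKWARD label the velocity obeys `dU/dσ = (1−γ)U + ∇P` exactly — momentum is
amplified at rate `1−γ` backward (damped forward) and driven only by the pressure gradient.
[cite: ConstantinIgnatovaVicol2026Putative, §3.1.1 eq. (3.3), §3.4 eq. (3.19)–(3.20)]; the
calculus is [folklore].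
-/

noncomputable section

set_option linter.dupNamespace false

open Set Metric Filter Topology Function InnerProductSpace MeasureTheory
open scoped RealInnerProductSpace

namespace Summit.NavierStokesRegularity.NavierStokesRegularity.Theorems.PowerGaugeEulerLiouville.Condenser

open Literature.Analysis Literature.Analysis.FluidPDE
open Summit.NavierStokesRegularity.NavierStokesRegularity.Theorems.PowerGaugeEulerLiouville

variable {γ : ℝ} {U V : EuclideanSpace ℝ (Fin 3) → EuclideanSpace ℝ (Fin 3)}
  {P : EuclideanSpace ℝ (Fin 3) → ℝ}

/-- The profile equation solved for the transport derivative: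
`−DU(z)[γz + U z] = (1−γ) U z + ∇P z`. [cite: ConstantinIgnatovaVicol2026Putative, §3.1.1 eq. (3.3)] -/
theorem neg_fderiv_transport_eq (hprof : IsSelfSimilarEulerProfile γ 0 U P)
    (z : EuclideanSpace ℝ (Fin 3)) :
    -(fderiv ℝ U z (selfSimilarTransport γ 0 U z)) = (1 - γ) • U z + gradient P z := by
  have e := hprof.profile_eq_transport z
  rw [neg_eq_iff_eq_neg]
  linear_combination (norm := module) e

/-- The gradient of the (`C¹`) pressure profile is continuous. [folklore] -/
theorem continuous_gradient_pressure (hprof : IsSelfSimilarEulerProfile γ 0 U P) :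
    Continuous (gradient P) := by
  have h : Continuous fun x => fderiv ℝ P x := hprof.contDiff_pressure.continuous_fderiv one_ne_zero
  exact (InnerProductSpace.toDual ℝ (EuclideanSpace ℝ (Fin 3))).symm.continuous.comp h

/-- **(D1) Velocity along a backward cut-off orbit, inside the ball.**  While `Ψ_σ y ∈ ball 0 R_big`
(where `V = U`), `d/dσ U(Ψ_σ y) = (1−γ) U(Ψ_σ y) + ∇P(Ψ_σ y)`.
[cite: ConstantinIgnatovaVicol2026Putative, §3.1.1 eq. (3.3)] -/
theorem hasDerivAt_velocity_flow_neg (hprof : IsSelfSimilarEulerProfile γ 0 U P)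
    (hV : ContDiff ℝ 1 V) {K : ℝ} (hK : ∀ y, ‖fderiv ℝ V y‖ ≤ K) {Rbig : ℝ}
    (hVU : ∀ w ∈ ball (0 : EuclideanSpace ℝ (Fin 3)) Rbig, V w = U w) (y : EuclideanSpace ℝ (Fin 3))
    {σ : ℝ}
    (hz : ODE.evolutionMap (fun _ : ℝ => selfSimilarTransport γ 0 V) 0 (-σ) y ∈
      ball (0 : EuclideanSpace ℝ (Fin 3)) Rbig) :
    HasDerivAt (fun r => U (ODE.evolutionMap (fun _ : ℝ => selfSimilarTransport γ 0 V) 0 (-r) y))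
      ((1 - γ) • U (ODE.evolutionMap (fun _ : ℝ => selfSimilarTransport γ 0 V) 0 (-σ) y) +
        gradient P (ODE.evolutionMap (fun _ : ℝ => selfSimilarTransport γ 0 V) 0 (-σ) y)) σ := by
  set z := ODE.evolutionMap (fun _ : ℝ => selfSimilarTransport γ 0 V) 0 (-σ) y with hzdef
  have h1 := (hprof.differentiable_velocity z).hasFDerivAt.comp_hasDerivAt σ
    (C2.Kelvin.hasDerivAt_flow_neg (γ := γ) hV hK y σ)
  have hW : selfSimilarTransport γ 0 V z = selfSimilarTransport γ 0 U z := by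
    rw [selfSimilarTransport_apply, selfSimilarTransport_apply, hVU z hz]
  have e : fderiv ℝ U z ((-1 : ℝ) • selfSimilarTransport γ 0 V z) = (1 - γ) • U z + gradient P z := by
    rw [map_smul, hW, neg_one_smul, neg_fderiv_transport_eq hprof z]
  rw [← hzdef] at h1
  rw [e] at h1
  exact h1

/-- **(D2)** The same paired with a fixed direction `e`:
`d/dσ ⟪U(Ψ_σ y), e⟫ = (1−γ)⟪U(Ψ_σ y), e⟫ + ⟪∇P(Ψ_σ y), e⟫`. [folklore] -/
theorem hasDerivAt_inner_velocity_flow_neg (hprof : IsSelfSimilarEulerProfile γ 0 U P)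
    (hV : ContDiff ℝ 1 V) {K : ℝ} (hK : ∀ y, ‖fderiv ℝ V y‖ ≤ K) {Rbig : ℝ}
    (hVU : ∀ w ∈ ball (0 : EuclideanSpace ℝ (Fin 3)) Rbig, V w = U w) (y : EuclideanSpace ℝ (Fin 3))
    (e : EuclideanSpace ℝ (Fin 3)) {σ : ℝ}
    (hz : ODE.evolutionMap (fun _ : ℝ => selfSimilarTransport γ 0 V) 0 (-σ) y ∈
      ball (0 : EuclideanSpace ℝ (Fin 3)) Rbig) :
    HasDerivAt
      (fun r => ⟪U (ODE.evolutionMap (fun _ : ℝ => selfSimilarTransport γ 0 V) 0 (-r) y), e⟫)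
      ((1 - γ) * ⟪U (ODE.evolutionMap (fun _ : ℝ => selfSimilarTransport γ 0 V) 0 (-σ) y), e⟫ +
        ⟪gradient P (ODE.evolutionMap (fun _ : ℝ => selfSimilarTransport γ 0 V) 0 (-σ) y), e⟫) σ := by
  have h := (hasDerivAt_velocity_flow_neg hprof hV hK hVU y hz).inner ℝ (hasDerivAt_const σ e)
  simp only [inner_zero_right, zero_add, inner_add_left, real_inner_smul_left] at h
  exact h

/-- **(D3)** With the integrating factor `e^{−(1−γ)σ}` the amplification term cancels:
`d/dσ (e^{−(1−γ)σ}⟪U(Ψ_σ y), e⟫) = e^{−(1−γ)σ}⟪∇P(Ψ_σ y), e⟫`. [folklore] -/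
theorem hasDerivAt_exp_mul_inner_velocity_flow_neg (hprof : IsSelfSimilarEulerProfile γ 0 U P)
    (hV : ContDiff ℝ 1 V) {K : ℝ} (hK : ∀ y, ‖fderiv ℝ V y‖ ≤ K) {Rbig : ℝ}
    (hVU : ∀ w ∈ ball (0 : EuclideanSpace ℝ (Fin 3)) Rbig, V w = U w) (y : EuclideanSpace ℝ (Fin 3))
    (e : EuclideanSpace ℝ (Fin 3)) {σ : ℝ}
    (hz : ODE.evolutionMap (fun _ : ℝ => selfSimilarTransport γ 0 V) 0 (-σ) y ∈
      ball (0 : EuclideanSpace ℝ (Fin 3)) Rbig) :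
    HasDerivAt
      (fun r => Real.exp (-((1 - γ) * r)) *
        ⟪U (ODE.evolutionMap (fun _ : ℝ => selfSimilarTransport γ 0 V) 0 (-r) y), e⟫)
      (Real.exp (-((1 - γ) * σ)) *
        ⟪gradient P (ODE.evolutionMap (fun _ : ℝ => selfSimilarTransport γ 0 V) 0 (-σ) y), e⟫) σ := by
  have h1 : HasDerivAt (fun r : ℝ => -((1 - γ) * r)) (-((1 - γ) * 1)) σ :=
    ((hasDerivAt_id' σ).const_mul (1 - γ)).neg
  have hexp : HasDerivAt (fun r : ℝ => Real.exp (-((1 - γ) * r)))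
      (Real.exp (-((1 - γ) * σ)) * (-((1 - γ) * 1))) σ := h1.exp
  have h : HasDerivAt
      (fun r => Real.exp (-((1 - γ) * r)) *
        ⟪U (ODE.evolutionMap (fun _ : ℝ => selfSimilarTransport γ 0 V) 0 (-r) y), e⟫)
      (Real.exp (-((1 - γ) * σ)) * (-((1 - γ) * 1)) *
          ⟪U (ODE.evolutionMap (fun _ : ℝ => selfSimilarTransport γ 0 V) 0 (-σ) y), e⟫ +
        Real.exp (-((1 - γ) * σ)) *
          ((1 - γ) * ⟪U (ODE.evolutionMap (fun _ : ℝ => selfSimilarTransport γ 0 V) 0 (-σ) y), e⟫ +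
            ⟪gradient P (ODE.evolutionMap (fun _ : ℝ => selfSimilarTransport γ 0 V) 0 (-σ) y), e⟫)) σ :=
    hexp.mul (hasDerivAt_inner_velocity_flow_neg hprof hV hK hVU y e hz)
  exact h.congr_deriv (by ring)

/-- **(D4) DUHAMEL along a backward orbit that stays in the ball on `[0, S]`:**
`e^{−(1−γ)S}⟪U(Ψ_S y), e⟫ − ⟪U y, e⟫ = ∫₀^S e^{−(1−γ)r}⟪∇P(Ψ_r y), e⟫ dr`. [folklore] -/
theorem exp_mul_inner_velocity_sub_eq_integral (hprof : IsSelfSimilarEulerProfile γ 0 U P)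
    (hV : ContDiff ℝ 1 V) {K : ℝ} (hK : ∀ y, ‖fderiv ℝ V y‖ ≤ K) {Rbig : ℝ}
    (hVU : ∀ w ∈ ball (0 : EuclideanSpace ℝ (Fin 3)) Rbig, V w = U w) (y : EuclideanSpace ℝ (Fin 3))
    (e : EuclideanSpace ℝ (Fin 3)) {S : ℝ} (hS : 0 ≤ S)
    (hin : ∀ r ∈ Icc (0 : ℝ) S, ODE.evolutionMap (fun _ : ℝ => selfSimilarTransport γ 0 V) 0 (-r) y ∈
      ball (0 : EuclideanSpace ℝ (Fin 3)) Rbig) :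
    Real.exp (-((1 - γ) * S)) *
        ⟪U (ODE.evolutionMap (fun _ : ℝ => selfSimilarTransport γ 0 V) 0 (-S) y), e⟫ - ⟪U y, e⟫ =
      ∫ r in (0 : ℝ)..S, Real.exp (-((1 - γ) * r)) *
        ⟪gradient P (ODE.evolutionMap (fun _ : ℝ => selfSimilarTransport γ 0 V) 0 (-r) y), e⟫ := by
  have hderiv : ∀ r ∈ uIcc (0 : ℝ) S, HasDerivAt
      (fun r => Real.exp (-((1 - γ) * r)) *
        ⟪U (ODE.evolutionMap (fun _ : ℝ => selfSimilarTransport γ 0 V) 0 (-r) y), e⟫)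
      (Real.exp (-((1 - γ) * r)) *
        ⟪gradient P (ODE.evolutionMap (fun _ : ℝ => selfSimilarTransport γ 0 V) 0 (-r) y), e⟫) r := by
    intro r hr
    rw [uIcc_of_le hS] at hr
    exact hasDerivAt_exp_mul_inner_velocity_flow_neg hprof hV hK hVU y e (hin r hr)
  -- backward orbits are continuous (cf. `NeedleClock.continuous_flow_neg_apply`)
  have hflow : Continuous fun r : ℝ =>
      ODE.evolutionMap (fun _ : ℝ => selfSimilarTransport γ 0 V) 0 (-r) y :=
    continuous_iff_continuousAt.2 fun r =>
      (C2.Kelvin.hasDerivAt_flow_neg (γ := γ) hV hK y r).continuousAt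
  have hcont : Continuous fun r : ℝ => Real.exp (-((1 - γ) * r)) *
      ⟪gradient P (ODE.evolutionMap (fun _ : ℝ => selfSimilarTransport γ 0 V) 0 (-r) y), e⟫ :=
    (Real.continuous_exp.comp ((continuous_const.mul continuous_id).neg)).mul
      (((continuous_gradient_pressure hprof).comp hflow).inner continuous_const)
  rw [intervalIntegral.integral_eq_sub_of_hasDerivAt hderiv (hcont.intervalIntegrable _ _)]
  simp [ODE.evolutionMap_self]

/-- **(D5) BOUND.**  For `γ < 1`, if the orbit stays in the ball on `[0, S]` and
`|⟪∇P(Ψ_r y), e⟫| ≤ B` there, then `|⟪U(Ψ_S y), e⟫| ≤ e^{(1−γ)S} (|⟪U y, e⟫| + B S)`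
(the spec's bound `Π` is spelled `B`: `Π` is a reserved token)
(crude: `e^{−(1−γ)r} ≤ 1` inside the Duhamel integral). [folklore] -/
theorem abs_inner_velocity_le_of_pressure_bound (hprof : IsSelfSimilarEulerProfile γ 0 U P)
    (hV : ContDiff ℝ 1 V) {K : ℝ} (hK : ∀ y, ‖fderiv ℝ V y‖ ≤ K) {Rbig : ℝ}
    (hVU : ∀ w ∈ ball (0 : EuclideanSpace ℝ (Fin 3)) Rbig, V w = U w) (y : EuclideanSpace ℝ (Fin 3))
    (e : EuclideanSpace ℝ (Fin 3)) {S : ℝ} (hS : 0 ≤ S)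
    (hin : ∀ r ∈ Icc (0 : ℝ) S, ODE.evolutionMap (fun _ : ℝ => selfSimilarTransport γ 0 V) 0 (-r) y ∈
      ball (0 : EuclideanSpace ℝ (Fin 3)) Rbig)
    (hγ : γ < 1) {B : ℝ}
    (hB : ∀ r ∈ Icc (0 : ℝ) S,
      |⟪gradient P (ODE.evolutionMap (fun _ : ℝ => selfSimilarTransport γ 0 V) 0 (-r) y), e⟫| ≤ B) :
    |⟪U (ODE.evolutionMap (fun _ : ℝ => selfSimilarTransport γ 0 V) 0 (-S) y), e⟫| ≤
      Real.exp ((1 - γ) * S) * (|⟪U y, e⟫| + B * S) := by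
  have hD := exp_mul_inner_velocity_sub_eq_integral hprof hV hK hVU y e hS hin
  -- the Duhamel integral is at most `B S`
  have hI : |∫ r in (0 : ℝ)..S, Real.exp (-((1 - γ) * r)) *
      ⟪gradient P (ODE.evolutionMap (fun _ : ℝ => selfSimilarTransport γ 0 V) 0 (-r) y), e⟫| ≤
      B * S := by
    have h := intervalIntegral.norm_integral_le_of_norm_le_const (a := (0 : ℝ)) (b := S) (C := B)
      (f := fun r => Real.exp (-((1 - γ) * r)) *
        ⟪gradient P (ODE.evolutionMap (fun _ : ℝ => selfSimilarTransport γ 0 V) 0 (-r) y), e⟫) ?_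
    · simpa [Real.norm_eq_abs, abs_of_nonneg hS] using h
    intro r hr
    rw [uIoc_of_le hS] at hr
    have hr' : r ∈ Icc (0 : ℝ) S := ⟨hr.1.le, hr.2⟩
    have hexp1 : Real.exp (-((1 - γ) * r)) ≤ 1 := by
      rw [Real.exp_le_one_iff]
      nlinarith [hr.1]
    rw [norm_mul, Real.norm_eq_abs, Real.norm_eq_abs, abs_of_pos (Real.exp_pos _)]
    calc Real.exp (-((1 - γ) * r)) *
          |⟪gradient P (ODE.evolutionMap (fun _ : ℝ => selfSimilarTransport γ 0 V) 0 (-r) y), e⟫|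
        ≤ 1 * B := mul_le_mul hexp1 (hB r hr') (abs_nonneg _) zero_le_one
      _ = B := one_mul B
  -- `e^{−(1−γ)S}|⟪U(Ψ_S), e⟫| ≤ |⟪U y, e⟫| + B S`
  set A := ⟪U (ODE.evolutionMap (fun _ : ℝ => selfSimilarTransport γ 0 V) 0 (-S) y), e⟫ with hA
  have h1 : Real.exp (-((1 - γ) * S)) * |A| ≤ |⟪U y, e⟫| + B * S := by
    have h2 : Real.exp (-((1 - γ) * S)) * A = ⟪U y, e⟫ + ∫ r in (0 : ℝ)..S,
        Real.exp (-((1 - γ) * r)) *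
          ⟪gradient P (ODE.evolutionMap (fun _ : ℝ => selfSimilarTransport γ 0 V) 0 (-r) y), e⟫ := by
      linarith
    rw [← abs_of_pos (Real.exp_pos (-((1 - γ) * S))), ← abs_mul, h2]
    exact (abs_add_le _ _).trans (by linarith)
  have hpos : 0 < Real.exp ((1 - γ) * S) := Real.exp_pos _
  have hkey : |A| = Real.exp ((1 - γ) * S) * (Real.exp (-((1 - γ) * S)) * |A|) := by
    rw [← mul_assoc, ← Real.exp_add, add_neg_cancel, Real.exp_zero, one_mul]
  rw [hkey]
  exact mul_le_mul_of_nonneg_left h1 hpos.le
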